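import Summits.ValiantsHypothesis.ValiantsHypothesis.Theorems.GrenetZeonDualUnipotentThreeHalvesHeavyTopHalfSpeedDefs

/-!
# Bi-inflations `J₄ ⊗ 𝒜 ⊕ R₂ ⊗ ℬ` — the two-sided inflation calculus (val-idea-31 g3, card `graded-thin-side` rev 3)

Crux `GrenetZeon.DualUnipotentThreeHalves` = stmt-ValiantsHypothesis-24318, residue R2 `HeavyTopLaw`; currency `RatioSpeed`
(val-idea-30 g2, `RatioSpeed.lean`, after `HALFSPEED-DEAD.md`).  VP ≠ VNP is NOT proved here; nothing in this file proves R2 / 24318.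

THEOREM OF RECORD for the one-sided inflation `U₄ₖ = J₄ ⊗ M_k ⊕ ℂ·R₂ ⊗ 1`: ✓ p667267
`Theorems/DualUnipotentThreeHalves/Negative/InflatedReturns.lean` (`infl_pow_four`, `inflSpace_nilpotent`, `inflSpace_irreducible`; witness
val-idea-30 g2, Lean crit-7 g2) and ✓ p667569 `not_halfSpeedIrrLaw`.  This file does NOT compete with it; what is here (sorry-free):
* `biInfl_pow_four` — ✓ the GENERAL COMMUTING bi-inflation is nil: `A·B = B·A ⇒ (J₄ ⊗ A + R₂ ⊗ B)⁴ = 0` (two-sided: BOTH coefficient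
  spaces may be fat, e.g. `𝒜 = M_a ⊗ 1`, `ℬ = 1 ⊗ M_b`; `B = s·1` is `U₄ₖ`, re-derived below as `infl_isNilpotent` on verbatim copies of
  `inflMat / inflSpace` only because the Cruxes module `InflatedReturns` is not importable from the farm snapshot tonight);
* `biInfl_pow_six_of_sqZero` — ✓ `A² = 0 ⇒ (J₄ ⊗ A + R₂ ⊗ B)⁶ = 0` for EVERY `B` (the square-zero side is free; card §BI (Z));
* the typed objects of the two-sided calculus: `BiInflNil 𝒜 ℬ`, `BiInflIrreducible 𝒜 ℬ`, the coefficient-form product law `BiInflProductLaw` (FALSE as typed — refuted by the family `F(k,S)`, crit-7 V18; kept as a typed negative)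
  («nil + irreducible ⇒ dim 𝒜 · dim ℬ ≤ C·k²»; commuting case = double centraliser, a theorem in print, typed as `CommutingProductBound`);
  exact nil criterion and data: `Ideas/graded-thin-side.md` rev 3 §BI (`tr M⁶ = 6·tr(A²[B,A]AB)`, …; `calc/biinfl*.py`).
-/

noncomputable section

set_option linter.dupNamespace false
set_option autoImplicit false
set_option linter.unusedSectionVars false

namespace Summit.ValiantsHypothesis.ValiantsHypothesis.Cruxes.DualUnipotentThreeHalves.GradedThinSide

open Matrix
open scoped Kronecker BigOperators
/-! ## §0 The base matrices (verbatim copies of `InflatedReturns.J4 / R2 / inflMat / inflSpace`, val-idea-30 g2 — that module is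
not yet in the farm's library snapshot, so it cannot be imported tonight; the bridge is `rfl` on each definition) -/

/-- `J₄ = E₁₂ + E₂₃ + E₃₄`. -/
def J4 : Matrix (Fin 4) (Fin 4) ℂ := !![0, 1, 0, 0; 0, 0, 1, 0; 0, 0, 0, 1; 0, 0, 0, 0]

/-- `R₂ = E₃₁ − E₄₂`. -/
def R2 : Matrix (Fin 4) (Fin 4) ℂ := !![0, 0, 0, 0; 0, 0, 0, 0; 1, 0, 0, 0; 0, -1, 0, 0]

/-- The inflated matrix `J₄ ⊗ A + s·(R₂ ⊗ 1_k)`, re-indexed to `Fin (4k)` (as in `InflatedReturns.inflMat`). -/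
def inflMat (k : ℕ) (A : Matrix (Fin k) (Fin k) ℂ) (s : ℂ) : Matrix (Fin (4 * k)) (Fin (4 * k)) ℂ :=
  Matrix.reindex finProdFinEquiv finProdFinEquiv
    (J4 ⊗ₖ A + s • (R2 ⊗ₖ (1 : Matrix (Fin k) (Fin k) ℂ)))

/-- `U₄ₖ` (as in `InflatedReturns.inflSpace`). -/
def inflSpace (k : ℕ) : Submodule ℂ (Matrix (Fin (4 * k)) (Fin (4 * k)) ℂ) :=
  Submodule.span ℂ (Set.range fun p : Matrix (Fin k) (Fin k) ℂ × ℂ => inflMat k p.1 p.2)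

/-! ## §1 Base identities in `M₄(ℂ)` -/

theorem R2_mul_R2 : R2 * R2 = 0 := by
  ext i j
  fin_cases i <;> fin_cases j <;> simp [R2, Matrix.mul_apply, Fin.sum_univ_four]

theorem J4_pow_four' : J4 * J4 * (J4 * J4) = 0 := by
  ext i j
  fin_cases i <;> fin_cases j <;> simp [J4, Matrix.mul_apply, Fin.sum_univ_four]

/-- The `(3 J, 1 R)` necklace: `J²K + KJ² = 0` for `K = JR + RJ` (the coefficient of `y` in `(J + yR)⁴ = 0`). -/
theorem J4_K_identity : J4 * J4 * (J4 * R2 + R2 * J4) + (J4 * R2 + R2 * J4) * (J4 * J4) = 0 := by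
  ext i j
  fin_cases i <;> fin_cases j <;> simp [J4, R2, Matrix.add_apply]

/-- The `(2 J, 2 R)` necklace: `K² = 0` for `K = JR + RJ` (uses `R² = 0`). -/
theorem K_mul_K : (J4 * R2 + R2 * J4) * (J4 * R2 + R2 * J4) = 0 := by
  ext i j
  fin_cases i <;> fin_cases j <;> simp [J4, R2, Matrix.mul_apply, Fin.sum_univ_four]

/-! ## §2 The commuting bi-inflation is nil -/

variable {k : ℕ}

/-- Square of a bi-inflation with commuting coefficients. -/
theorem biInfl_sq (A B : Matrix (Fin k) (Fin k) ℂ) (h : A * B = B * A) :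
    (J4 ⊗ₖ A + R2 ⊗ₖ B) * (J4 ⊗ₖ A + R2 ⊗ₖ B) = (J4 * J4) ⊗ₖ (A * A) + (J4 * R2 + R2 * J4) ⊗ₖ (A * B) := by
  rw [add_mul, mul_add, mul_add, ← Matrix.mul_kronecker_mul, ← Matrix.mul_kronecker_mul, ← Matrix.mul_kronecker_mul,
    ← Matrix.mul_kronecker_mul, R2_mul_R2, Matrix.zero_kronecker, add_zero, ← h, Matrix.add_kronecker, add_assoc]

/-- ✓ **Commuting bi-inflations are nil (index 4).** -/
theorem biInfl_pow_four (A B : Matrix (Fin k) (Fin k) ℂ) (h : A * B = B * A) : (J4 ⊗ₖ A + R2 ⊗ₖ B) ^ 4 = 0 := by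
  have hc : A * B * (A * A) = A * A * (A * B) := by
    calc A * B * (A * A) = A * (B * A) * A := by simp only [Matrix.mul_assoc]
      _ = A * (A * B) * A := by rw [← h]
      _ = A * A * (B * A) := by simp only [Matrix.mul_assoc]
      _ = A * A * (A * B) := by rw [← h]
  have e : (J4 ⊗ₖ A + R2 ⊗ₖ B) ^ 4 = ((J4 ⊗ₖ A + R2 ⊗ₖ B) * (J4 ⊗ₖ A + R2 ⊗ₖ B)) *
      ((J4 ⊗ₖ A + R2 ⊗ₖ B) * (J4 ⊗ₖ A + R2 ⊗ₖ B)) := by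
    simp only [pow_succ, pow_zero, one_mul, Matrix.mul_assoc]
  rw [e, biInfl_sq A B h, add_mul, mul_add, mul_add,
    ← Matrix.mul_kronecker_mul, ← Matrix.mul_kronecker_mul, ← Matrix.mul_kronecker_mul, ← Matrix.mul_kronecker_mul,
    J4_pow_four', Matrix.zero_kronecker, zero_add, K_mul_K, Matrix.zero_kronecker, add_zero, hc,
    ← Matrix.add_kronecker, J4_K_identity, Matrix.zero_kronecker]

/-! ## §2b The square-zero side is free: `A² = 0 ⇒ (J₄ ⊗ A + R₂ ⊗ B)⁶ = 0` for EVERY `B` (card §BI (Z)) -/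

theorem J4_R2_R2 : J4 * R2 * R2 = 0 := by rw [Matrix.mul_assoc, R2_mul_R2, Matrix.mul_zero]

theorem JRJ_mul_RJR : J4 * R2 * J4 * (R2 * J4 * R2) = 0 := by
  ext i j
  fin_cases i <;> fin_cases j <;> simp [J4, R2, Matrix.mul_apply, Fin.sum_univ_four]

theorem RJR_mul_JRJ : R2 * J4 * R2 * (J4 * R2 * J4) = 0 := by
  ext i j
  fin_cases i <;> fin_cases j <;> simp [J4, R2, Matrix.mul_apply, Fin.sum_univ_four]

theorem RJR_mul_RJR : R2 * J4 * R2 * (R2 * J4 * R2) = 0 := by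
  ext i j
  fin_cases i <;> fin_cases j <;> simp [J4, R2, Matrix.mul_apply, Fin.sum_univ_four]

/-- Square of a bi-inflation whose `J`-coefficient squares to zero (no commutation assumed). -/
theorem biInfl_sq_of_sqZero (A B : Matrix (Fin k) (Fin k) ℂ) (hA : A * A = 0) :
    (J4 ⊗ₖ A + R2 ⊗ₖ B) * (J4 ⊗ₖ A + R2 ⊗ₖ B) = (J4 * R2) ⊗ₖ (A * B) + (R2 * J4) ⊗ₖ (B * A) := by
  rw [add_mul, mul_add, mul_add, ← Matrix.mul_kronecker_mul, ← Matrix.mul_kronecker_mul, ← Matrix.mul_kronecker_mul,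
    ← Matrix.mul_kronecker_mul, R2_mul_R2, Matrix.zero_kronecker, add_zero, hA, Matrix.kronecker_zero, zero_add]

/-- Cube: only the alternating words survive. -/
theorem biInfl_cube_of_sqZero (A B : Matrix (Fin k) (Fin k) ℂ) (hA : A * A = 0) :
    (J4 ⊗ₖ A + R2 ⊗ₖ B) * (J4 ⊗ₖ A + R2 ⊗ₖ B) * (J4 ⊗ₖ A + R2 ⊗ₖ B) =
      (J4 * R2 * J4) ⊗ₖ (A * B * A) + (R2 * J4 * R2) ⊗ₖ (B * A * B) := by
  have hB : B * A * A = 0 := by rw [Matrix.mul_assoc, hA, Matrix.mul_zero]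
  rw [biInfl_sq_of_sqZero A B hA, add_mul, mul_add, mul_add, ← Matrix.mul_kronecker_mul, ← Matrix.mul_kronecker_mul,
    ← Matrix.mul_kronecker_mul, ← Matrix.mul_kronecker_mul, J4_R2_R2, Matrix.zero_kronecker, add_zero, hB,
    Matrix.kronecker_zero, zero_add]

/-- ✓ **(Z)** If `A² = 0` then `J₄ ⊗ A + R₂ ⊗ B` has sixth power `0`, whatever `B` is: the `J`-side of a bi-inflation may be any
square-zero space for free (but such spaces never give irreducible bi-inflations — Nakayama flag, card §BI (Z)). -/
theorem biInfl_pow_six_of_sqZero (A B : Matrix (Fin k) (Fin k) ℂ) (hA : A * A = 0) : (J4 ⊗ₖ A + R2 ⊗ₖ B) ^ 6 = 0 := by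
  have hc : A * B * A * (A * B * A) = 0 := by
    calc A * B * A * (A * B * A) = A * B * (A * A) * (B * A) := by simp only [Matrix.mul_assoc]
      _ = 0 := by rw [hA, Matrix.mul_zero, Matrix.zero_mul]
  have e : (J4 ⊗ₖ A + R2 ⊗ₖ B) ^ 6 = ((J4 ⊗ₖ A + R2 ⊗ₖ B) * (J4 ⊗ₖ A + R2 ⊗ₖ B) * (J4 ⊗ₖ A + R2 ⊗ₖ B)) *
      ((J4 ⊗ₖ A + R2 ⊗ₖ B) * (J4 ⊗ₖ A + R2 ⊗ₖ B) * (J4 ⊗ₖ A + R2 ⊗ₖ B)) := by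
    simp only [pow_succ, pow_zero, one_mul, Matrix.mul_assoc]
  rw [e, biInfl_cube_of_sqZero A B hA, add_mul, mul_add, mul_add,
    ← Matrix.mul_kronecker_mul, ← Matrix.mul_kronecker_mul, ← Matrix.mul_kronecker_mul, ← Matrix.mul_kronecker_mul,
    hc, Matrix.kronecker_zero, zero_add, JRJ_mul_RJR, Matrix.zero_kronecker, zero_add, RJR_mul_JRJ, Matrix.zero_kronecker,
    zero_add, RJR_mul_RJR, Matrix.zero_kronecker]

/-- Powers commute with reindexing along an equivalence (folklore). -/
theorem submatrix_pow_equiv' {l m : Type*} [Fintype l] [Fintype m] [DecidableEq l] [DecidableEq m]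
    (M : Matrix m m ℂ) (e : l ≃ m) (j : ℕ) : (M.submatrix e e) ^ j = (M ^ j).submatrix e e := by
  induction j with
  | zero => rw [pow_zero, pow_zero, Matrix.submatrix_one_equiv]
  | succ j ih => rw [pow_succ, ih, Matrix.submatrix_mul_equiv, ← pow_succ]

/-- The inflated matrix of `HALFSPEED-DEAD.md` is a commuting bi-inflation (`B = s·1`), hence has fourth power `0`. -/
theorem inflMat_pow_four (A : Matrix (Fin k) (Fin k) ℂ) (s : ℂ) : inflMat k A s ^ 4 = 0 := by
  have h2 : (J4 ⊗ₖ A + R2 ⊗ₖ (s • (1 : Matrix (Fin k) (Fin k) ℂ))) ^ 4 = 0 :=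
    biInfl_pow_four A _ (by rw [Matrix.mul_smul, Matrix.smul_mul, Matrix.mul_one, Matrix.one_mul])
  unfold inflMat
  rw [← Matrix.kronecker_smul, Matrix.reindex_apply, submatrix_pow_equiv', h2, Matrix.submatrix_zero, Pi.zero_apply,
    Pi.zero_apply]

/-- The inflation map `(A, s) ↦ inflMat k A s` is linear; hence `inflSpace k` IS its range. -/
def inflLin (k : ℕ) : (Matrix (Fin k) (Fin k) ℂ × ℂ) →ₗ[ℂ] Matrix (Fin (4 * k)) (Fin (4 * k)) ℂ where
  toFun p := inflMat k p.1 p.2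
  map_add' p q := by
    ext i j
    simp only [inflMat, Matrix.reindex_apply, Matrix.submatrix_apply, Matrix.add_apply, Matrix.smul_apply,
      Prod.fst_add, Prod.snd_add, Matrix.kroneckerMap_apply, smul_eq_mul]
    ring
  map_smul' c p := by
    ext i j
    simp only [inflMat, Matrix.reindex_apply, Matrix.submatrix_apply, Matrix.add_apply, Matrix.smul_apply,
      Prod.smul_fst, Prod.smul_snd, Matrix.kroneckerMap_apply, smul_eq_mul, RingHom.id_apply]
    ring

theorem inflSpace_eq_range (k : ℕ) : inflSpace k = LinearMap.range (inflLin k) := by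
  unfold inflSpace
  have : (Set.range fun p : Matrix (Fin k) (Fin k) ℂ × ℂ => inflMat k p.1 p.2) = (LinearMap.range (inflLin k) : Set _) := by
    ext X
    simp only [Set.mem_range, SetLike.mem_coe, LinearMap.mem_range]
    constructor
    · rintro ⟨p, hp⟩; exact ⟨p, hp⟩
    · rintro ⟨p, hp⟩; exact ⟨p, hp⟩
  rw [this, Submodule.span_eq]

/-- Every member of `U₄ₖ` is nilpotent (re-derivation via `biInfl_pow_four`; theorem of record ✓ p667267 `inflSpace_nilpotent`). -/
theorem infl_isNilpotent (k : ℕ) : ∀ X ∈ inflSpace k, IsNilpotent X := by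
  intro X hX
  rw [inflSpace_eq_range] at hX
  obtain ⟨p, rfl⟩ := hX
  exact ⟨4, inflMat_pow_four p.1 p.2⟩

/-! ## §3 Typed objects of the two-sided calculus (statements; the law is a CONJECTURE, not asserted) -/

/-- The bi-inflation space is nil: every `J₄ ⊗ A + R₂ ⊗ B`, `A ∈ 𝒜`, `B ∈ ℬ`, is nilpotent.  (For `p = 4` this is the
family of necklace identities `tr M^{3j} = 0`: `tr M⁶ = 6·tr(A²[B,A]AB)`, `tr M⁹ = 9·(tr(A³BA²BAB) − tr(A³BABA²B))`, …;
they vanish identically when `[𝒜, ℬ] = 0` — `biInfl_pow_four`.) -/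
def BiInflNil (𝒜 ℬ : Submodule ℂ (Matrix (Fin k) (Fin k) ℂ)) : Prop :=
  ∀ A ∈ 𝒜, ∀ B ∈ ℬ, IsNilpotent (J4 ⊗ₖ A + R2 ⊗ₖ B)

/-- The bi-inflation space acts irreducibly on `ℂ⁴ ⊗ ℂᵏ`. -/
def BiInflIrreducible (𝒜 ℬ : Submodule ℂ (Matrix (Fin k) (Fin k) ℂ)) : Prop :=
  ∀ V : Submodule ℂ (Fin 4 × Fin k → ℂ),
    (∀ A ∈ 𝒜, ∀ B ∈ ℬ, ∀ x ∈ V, (J4 ⊗ₖ A + R2 ⊗ₖ B) *ᵥ x ∈ V) → V = ⊥ ∨ V = ⊤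

/-- **(PL-tensor, coefficient form) — FALSE AS TYPED** (refuted-misstated; val-idea-31 g3's own family `F(k,S)` of the card
`Ideas/graded-thin-side.md` §BI (F), with crit-7's ∀k proofs, VERDICT #18): for `S = {3,…,k}`, `𝒜 = ℂ1 ⊕ {e₁xᵀ : supp x ⊆ S}`,
`ℬ = {B : (Be₁)_S = 0}` the pair is nil (nil-index 10) and irreducible for every `k ≥ 3`, with `dim 𝒜 · dim ℬ = (k−1)(k²−k+2) > C·k²`
for `k ≥ C + 3`.  The sides of the true product law (PL) are NOT the coefficient spaces but the sides of a cocharacter of the FULL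
stabiliser torus (for `F(k,S)`: thin side `{J₄⊗1}`, `ρ = 1`) — that repaired form is `GradedProfileRatio.ThinReturnLaw`; this coefficient
form keeps no independent content and stays here only as a typed negative.  Commuting case (`[𝒜,ℬ] = 0`): `dim 𝒜 · dim ℬ ≤ k²` does hold
(double centraliser; `DoubleCentralizerBound.finrank_mul_finrank_le_sq_of_commute` for `alg(𝒜)` simple).  Data of record: nil irreducible
pairs with coefficient product `> k²` exist already at `k = 3` (`F(3,{3})`: 16 > 9; `F(4,{3,4})`: 42 > 16).  NOT asserted. -/
def BiInflProductLaw : Prop :=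
  ∃ C : ℕ, ∀ (k : ℕ) (𝒜 ℬ : Submodule ℂ (Matrix (Fin k) (Fin k) ℂ)),
    BiInflNil 𝒜 ℬ → BiInflIrreducible 𝒜 ℬ → Module.finrank ℂ 𝒜 * Module.finrank ℂ ℬ ≤ C * k ^ 2

/-- The commuting case of the product law (double-centraliser theorem; in print, e.g. Jacobson, Basic Algebra II §4.6):
two elementwise-commuting matrix spaces that jointly generate `M_k(ℂ)` have `dim 𝒜 · dim ℬ ≤ k²`.  Typed; the case «`alg(𝒜)` simple» is
PROVED by name from the tree's double centraliser theorem in `Cruxes/DualUnipotentThreeHalves/DoubleCentralizerBound.lean`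
(`finrank_mul_finrank_le_sq_of_commute`); the remaining step «commuting + jointly generating ⇒ `alg(𝒜)` simple» (Jacobson radical of
`alg(𝒜)` times `alg(ℬ)` is a nilpotent ideal of `M_k`; centre is central) is M-sized prover food. -/
def CommutingProductBound : Prop :=
  ∀ (k : ℕ) (𝒜 ℬ : Submodule ℂ (Matrix (Fin k) (Fin k) ℂ)),
    (∀ A ∈ 𝒜, ∀ B ∈ ℬ, A * B = B * A) →
    Algebra.adjoin ℂ ((𝒜 : Set (Matrix (Fin k) (Fin k) ℂ)) ∪ ℬ) = ⊤ →
    Module.finrank ℂ 𝒜 * Module.finrank ℂ ℬ ≤ k ^ 2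

end Summit.ValiantsHypothesis.ValiantsHypothesis.Cruxes.DualUnipotentThreeHalves.GradedThinSide

end
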